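/-
Copyright (c) 2026 the pub-hodgecm-mathlib formalisation cell (harness21).  Prover seat hodgecm-mathlib-K2E2-p12 (g6): Track B «K2-LIT», ENGINE E1,
h413 = stmt-HodgeConjecture-24833; R8₂-sph ROAD T′, rulings (110)(2)∕(116) of K2E1-plan (g6): (A3) THE MULTIPLICITY-ONE ASSEMBLY ON THE LETTER `hcommHecke`.
-/
import Summits.HodgeConjecture.HodgeConjecture.Theorems.K2E1HeckeClosureKFixedU          -- ★ T8∕(A1) (this seat, g5, p859582): `inf_eq_of_isTopIrreducible_of_stable`
import Summits.HodgeConjecture.HodgeConjecture.Theorems.K2E1CuspidalSpectrumUnitaryDefsR   -- ★ `cmResidualSubspaceR` (CM print), `rightRegular`, `isUnitary_rightRegular`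
import Literature.NumberTheory.Automorphic.HilbertRepSchur                                 -- ★ `IsIrreducibleFamily`, `IsIrreducibleFamily.exists_eq_algebraMap` (Schur, Deitmar–Echterhoff 5.1.6)
import Mathlib.Analysis.InnerProductSpace.Projection.Basic
import Mathlib.Analysis.InnerProductSpace.Adjoint
import Mathlib.LinearAlgebra.FiniteDimensional.Basic
import Mathlib.Topology.Algebra.Module.FiniteDimension
import HarnessLib

/-!
# K2·E1 — `K2E1ResidualSphericalMultiplicityOneOfLetters` (ruling (110)(2), step (A3) of road (A) GELFAND): COMMUTING HECKE OPERATORS ON THE `K`-FIXED VECTORS OF AN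
# IRREDUCIBLE UNITARY `Π` FORCE `dim Π^K ≤ 1`; HENCE T9's ADMISSIBILITY LETTER `hadm` [Deitmar–Echterhoff Thm. 5.1.6, Lemma 6.1.7; Bump Thm. 2.4.2 «uniqueness of the K-fixed vector» ∕ Thm. 4.6.2; Garrett p. 331]

Track B ∕ K2-LIT, crux h413 = `stmt-HodgeConjecture-24833`, route of record `HCCMUnconditional`; cell `hodgecm-mathlib`, squad K2, ENGINE E1 (R8₂-sph ROAD T′, road (A)
GELFAND of the (ADM) census `K2/K2E2-p12/g5/CENSUS-ADM-R8sph.K2E2-p12-g5.md`).  THEOREMS ONLY (no `def`, no `instance`, no notation, no `sorry`; default heartbeats); lane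
`--supports stmt-HodgeConjecture-24833 --as helper` (count-neutral).  HYPOTHESIS-FIRST on ONE letter:

  `hcommHecke : ∀ g₁ g₂, ∀ v ∈ Π.toSubmodule ⊓ Kfix, P (π g₁ (P (π g₂ v))) = P (π g₂ (P (π g₁ v)))`

(`P = P_K` the orthogonal projection onto the `K`-fixed vectors `Kfix`; the operators `P π(g) P|_{V^K}` are the Hecke operators of the double cosets `KgK`, so the letter is the operator
form of «the Hecke algebra `𝓗(G∕∕K)` is commutative», i.e. `(G, K)` is a Gelfand pair — payable place by place: Satake at unramified places, [Macdonald1971]∕[Cartier1979 §4] at special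
maximal compacts, Gelfand's trick at infinity).  THE ARGUMENT (generic, measure-free): for `Π` topologically irreducible and `π` unitary, `E := Π ⊓ Kfix` is a closed subspace, hence a
Hilbert space, carrying the bounded operators `T_g := (P ∘ π g)|_E` (they preserve `Π` because `P_K` does — unitarity splits `Kfix = (Kfix ∩ Π) ⊕ (Kfix ∩ Πᗮ)` — and land in `Kfix`);
the family `{T_g}` is ADJOINT-CLOSED (`T_g† = T_{g⁻¹}`: `P` symmetric, `π` unitary), COMMUTATIVE (the letter) and TOPOLOGICALLY IRREDUCIBLE on `E` (a non-zero closed `{T_g}`-stable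
`W ≤ E` is `E` by ★ T8∕(A1) `inf_eq_of_isTopIrreducible_of_stable`); Schur for irreducible self-adjoint operator families ★ `IsIrreducibleFamily.exists_eq_algebraMap` makes every
`T_g` a scalar, so every line `ℂv₀ ≤ E` is closed and stable, hence `= E`: **`Π ⊓ Kfix = ℂ ∙ v₀`**, in particular FINITE-DIMENSIONAL of `finrank ≤ 1`.
* §1 `exists_forall_smul_eq_of_isIrreducibleFamily` — a commutative adjoint-closed irreducible operator family acts on a space of dimension `≤ 1`.
* §2 `apply_mem_of_symmetric_of_fixed` — the orthogonal projection onto the `K`-fixed vectors preserves every closed invariant subspace (unitary `π`).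
* §3 **`inf_eq_span_singleton_of_commute`** (HEAD, generic symmetric `P` with `P|_{Kfix} = id`, `P(V) ⊆ Kfix`), `finiteDimensional_inf_of_commute`, `finrank_inf_le_one_of_commute`.
* §4 the same with `P := Kfix.starProjection` (Mathlib): `hasOrthogonalProjection_of_fixed`, **`inf_eq_span_singleton_of_hcommHecke`**, `finiteDimensional_inf_of_hcommHecke`,
  `finrank_inf_le_one_of_hcommHecke`; and T9's letter shape **`hadm_of_hcommHecke (Res) : ∀ W ≤ Res, W irreducible → FiniteDimensional ℂ ↥(W.toSubmodule ⊓ Kfix)`**.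
* §5 CM prints at `L²_res(U(Φ_N))` = ★ `cmResidualSubspaceR L N μ`: **`cmResidualSubspaceR_hadm_of_hcommHecke`** (= ★ p859502's `hadm`, N = 2, and its N = 3 twin, on the letter).
HONEST LABEL: HC_CM is proved only modulo the 7 printed citations (2 remaining named inputs: hLiu418 = `stmt-HodgeConjecture-24832`, h413 = `stmt-HodgeConjecture-24833`) until rung 0
closes; this file asserts no named fact and closes no socket; count-neutral; the letter `hcommHecke` is a hypothesis, not a fact.

## References
* [DeitmarEchterhoff2014] A. Deitmar, S. Echterhoff, *Principles of Harmonic Analysis*, 2nd ed. (2014): Thm. 5.1.6 (Schur for operator families), Lemma 6.1.7, Lemma 7.3.1.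
* [Bump1997] D. Bump, *Automorphic Forms and Representations* (1997): Thm. 2.4.2 («uniqueness of the `K`-fixed vector»: `dim 𝔥^K ≤ 1` for irreducible unitary `𝔥` when
  `C_c^∞(K∖G∕K)` acts commutatively — stated there under a compactness hypothesis which, as Bump notes, is unnecessary; here it is removed by Schur's lemma for self-adjoint families), Thm. 3.6.1, Thm. 4.6.2.
* [Garrett2018] P. Garrett, *Modern Analysis of Automorphic Forms by Example* (2018): p. 331.
* [Macdonald1971] I. G. Macdonald, *Spherical functions on a group of p-adic type* (1971): Thm. 3.3.6 (commutativity of `𝓗(G, K)` for special `K`).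
-/

set_option autoImplicit false
set_option linter.dupNamespace false -- the mandated namespace repeats `HodgeConjecture.HodgeConjecture`

noncomputable section

open scoped InnerProductSpace
open MeasureTheory NumberField ContRepresentation ContRepresentation.ClosedSubrep
open Literature.NumberTheory.Automorphic Literature.NumberTheory.Automorphic.UnitaryGroup
open Summit.HodgeConjecture.HodgeConjecture.Cruxes.H413.K2E1HeckeClosureKFixedU (inf_eq_of_isTopIrreducible_of_stable)
open Summit.HodgeConjecture.HodgeConjecture.Cruxes.H413.K2E1CuspidalSpectrumUnitary (cmResidualSubspaceR)

namespace Summit.HodgeConjecture.HodgeConjecture.Cruxes.H413.K2E1ResidualSphericalMultiplicityOneOfLetters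

/-! ## §1 A commutative, adjoint-closed, topologically irreducible operator family acts on a space of dimension `≤ 1` -/

section Family

variable {E : Type*} [NormedAddCommGroup E] [InnerProductSpace ℂ E] [CompleteSpace E]

/-- **SCHUR ⇒ DIMENSION `≤ 1`**: if a set `𝒮` of bounded operators on a complex Hilbert space is closed under adjoints, pairwise commuting, and topologically irreducible, then the space
is spanned by one vector: every `S ∈ 𝒮` commutes with `𝒮`, hence is a scalar (★ Schur `IsIrreducibleFamily.exists_eq_algebraMap`), so every line `ℂ ∙ v₀` is a closed
`𝒮`-stable subspace, hence everything. [cite: DeitmarEchterhoff2014, Thm. 5.1.6] [cite: Bump1997, Thm. 2.4.2] -/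
theorem exists_forall_smul_eq_of_isIrreducibleFamily {𝒮 : Set (E →L[ℂ] E)} (h𝒮 : IsIrreducibleFamily 𝒮)
    (hstar : ∀ S ∈ 𝒮, ContinuousLinearMap.adjoint S ∈ 𝒮) (hcomm : ∀ S ∈ 𝒮, ∀ T ∈ 𝒮, Commute S T) :
    ∃ v₀ : E, ∀ v : E, ∃ c : ℂ, c • v₀ = v := by
  have hscal : ∀ S ∈ 𝒮, ∃ a : ℂ, S = algebraMap ℂ (E →L[ℂ] E) a := fun S hS =>
    h𝒮.exists_eq_algebraMap hstar fun T hT => hcomm T hT S hS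
  by_cases h0 : ∀ v : E, v = 0
  · exact ⟨0, fun v => ⟨0, by rw [h0 v, smul_zero]⟩⟩
  push Not at h0
  obtain ⟨v₀, hv₀⟩ := h0
  refine ⟨v₀, fun v => ?_⟩
  have hline := h𝒮 (ℂ ∙ v₀) (Submodule.closed_of_finiteDimensional _) (by
    intro S hS w hw
    obtain ⟨a, ha⟩ := hscal S hS
    rw [ha, ContinuousLinearMap.algebraMap_apply]
    exact Submodule.smul_mem _ a hw)
  rcases hline with hbot | htop
  · exact absurd (Submodule.span_singleton_eq_bot.mp hbot) hv₀
  · have hv : v ∈ (ℂ ∙ v₀) := by rw [htop]; exact Submodule.mem_top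
    exact Submodule.mem_span_singleton.mp hv

end Family

/-! ## §2 The orthogonal projection onto the `K`-fixed vectors preserves closed invariant subspaces of a unitary representation -/

section Projection

variable {G V : Type*} [Group G] [NormedAddCommGroup V] [InnerProductSpace ℂ V] [CompleteSpace V] {π : ContRepresentation ℂ G V}

omit [CompleteSpace V] in
/-- For a SYMMETRIC operator `P` fixing `Kfix` pointwise, `v - P v ⟂ Kfix`. [cite: DeitmarEchterhoff2014, Lemma 7.3.1] -/
theorem sub_apply_mem_orthogonal_of_symmetric (Kfix : Submodule ℂ V) (P : V →L[ℂ] V) (hPsymm : ∀ x y : V, ⟪P x, y⟫_ℂ = ⟪x, P y⟫_ℂ)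
    (hPfix : ∀ w ∈ Kfix, P w = w) (v : V) : v - P v ∈ Kfixᗮ := by
  rw [Submodule.mem_orthogonal]
  intro w hw
  rw [inner_sub_right, ← hPsymm, hPfix w hw, sub_self]

/-- **`P_K` PRESERVES CLOSED INVARIANT SUBSPACES** (unitary `π`): for `K ⊆ G` with fixed vectors `Kfix`, `P` symmetric with `P|_{Kfix} = id`, `P(V) ⊆ Kfix` (i.e. `P = P_K`), and `Π` a
closed invariant subspace, `P(Π) ⊆ Π`.  Reason: `Π` and `Πᗮ` are invariant, so a `K`-fixed vector has `K`-fixed components in `Π ⊕ Πᗮ`; for `v ∈ Π` the `Πᗮ`-component `q'` of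
`P v` is then `K`-fixed and orthogonal to both `v` and `v - P v`, hence to itself. [cite: DeitmarEchterhoff2014, Lemma 7.3.1] [cite: Bump1997, Thm. 2.4.2] -/
theorem apply_mem_of_symmetric_of_fixed (hu : π.IsUnitary) (Q : ClosedSubrep π) {S : Type*} [SetLike S G] (K : S)
    (Kfix : Submodule ℂ V) (hKfix : ∀ v : V, v ∈ Kfix ↔ ∀ k ∈ K, π k v = v)
    (P : V →L[ℂ] V) (hPsymm : ∀ x y : V, ⟪P x, y⟫_ℂ = ⟪x, P y⟫_ℂ) (hPfix : ∀ w ∈ Kfix, P w = w) (hPK : ∀ v : V, P v ∈ Kfix) :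
    ∀ v ∈ Q, P v ∈ Q := by
  intro v hv
  set p : V := P v with hp
  have hpK : p ∈ Kfix := hPK v
  -- the `Π`-component `q` of `p` and the `Πᗮ`-component `p - q`
  set q : V := Q.toSubmodule.starProjection p with hq
  have hqQ : q ∈ Q.toSubmodule := Submodule.starProjection_apply_mem _ p
  have hq' : p - q ∈ Q.toSubmoduleᗮ := Submodule.sub_starProjection_mem_orthogonal p
  -- `q` is `K`-fixed
  have hqK : q ∈ Kfix := by
    rw [hKfix]
    intro k hk
    have hkp : π k p = p := (hKfix p).1 hpK k hk
    have hdQ : π k q - q ∈ Q.toSubmodule := Q.toSubmodule.sub_mem (Q.apply_mem k hqQ) hqQ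
    have hdQ' : π k q - q ∈ Q.toSubmoduleᗮ := by
      have h1 : π k (p - q) - (p - q) ∈ Q.toSubmoduleᗮ :=
        Q.toSubmoduleᗮ.sub_mem ((Q.orthogonal hu).apply_mem k hq') hq'
      have h2 : π k (p - q) - (p - q) = -(π k q - q) := by rw [map_sub, hkp]; abel
      rw [h2] at h1
      exact (neg_mem_iff).1 h1
    have h0 : π k q - q ∈ Q.toSubmodule ⊓ Q.toSubmoduleᗮ := ⟨hdQ, hdQ'⟩
    rw [Submodule.inf_orthogonal_eq_bot, Submodule.mem_bot] at h0
    exact sub_eq_zero.1 h0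
  have hq'K : p - q ∈ Kfix := Kfix.sub_mem hpK hqK
  -- `p - q` is orthogonal to itself
  have hvp : v - p ∈ Kfixᗮ := sub_apply_mem_orthogonal_of_symmetric Kfix P hPsymm hPfix v
  have h1 : ⟪p - q, v⟫_ℂ = 0 := Submodule.inner_left_of_mem_orthogonal hv hq'
  have h2 : ⟪p - q, v - p⟫_ℂ = 0 := Submodule.inner_right_of_mem_orthogonal hq'K hvp
  have h3 : ⟪p - q, q⟫_ℂ = 0 := Submodule.inner_left_of_mem_orthogonal hqQ hq'
  have h4 : ⟪p - q, p⟫_ℂ = ⟪p - q, v⟫_ℂ - ⟪p - q, v - p⟫_ℂ := by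
    rw [← inner_sub_right, sub_sub_cancel]
  have hself : ⟪p - q, p - q⟫_ℂ = 0 := by
    rw [inner_sub_right, h3, sub_zero, h4, h1, h2, sub_zero]
  have hpq : p - q = 0 := inner_self_eq_zero.1 hself
  rw [sub_eq_zero] at hpq
  rw [hpq]
  exact hqQ

end Projection

/-! ## §3 THE HEAD (generic symmetric `P = P_K`): commuting Hecke operators on `Π ⊓ Kfix` ⇒ `Π ⊓ Kfix` is a line (or zero) -/

section Head

variable {G V : Type*} [Group G] [NormedAddCommGroup V] [InnerProductSpace ℂ V] [CompleteSpace V] {π : ContRepresentation ℂ G V}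

/-- **(A3) MULTIPLICITY ONE OF THE TRIVIAL `K`-TYPE ON THE LETTER `hcommHecke`** (generic form).  `π` unitary, `Π` a topologically irreducible closed subrepresentation, `K ⊆ G` with fixed
vectors `Kfix`, `P` the orthogonal projection onto `Kfix` presented by its three properties (symmetric, `P|_{Kfix} = id`, `P(V) ⊆ Kfix`), and the LETTER: the Hecke operators
`P π(g) P` commute on `Π ⊓ Kfix`.  Then **`Π ⊓ Kfix = ℂ ∙ v₀`** for some `v₀ ∈ Π ⊓ Kfix`: the operators `T_g = (P π(g))|_{Π ⊓ Kfix}` form an adjoint-closed (`T_g† = T_{g⁻¹}`),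
commutative, topologically irreducible (★ T8∕(A1)) family on the Hilbert space `Π ⊓ Kfix`, and §1 applies. [cite: DeitmarEchterhoff2014, Thm. 5.1.6 and Lemma 6.1.7] [cite: Bump1997, Thm. 2.4.2 and Thm. 4.6.2] [cite: Garrett2018, p. 331] -/
theorem inf_eq_span_singleton_of_commute (hu : π.IsUnitary) {Q : ClosedSubrep π} (hQ : Q.toContRep.IsTopIrreducible)
    {S : Type*} [SetLike S G] (K : S) (Kfix : Submodule ℂ V) (hKfix : ∀ v : V, v ∈ Kfix ↔ ∀ k ∈ K, π k v = v)
    (P : V →L[ℂ] V) (hPsymm : ∀ x y : V, ⟪P x, y⟫_ℂ = ⟪x, P y⟫_ℂ) (hPfix : ∀ w ∈ Kfix, P w = w) (hPK : ∀ v : V, P v ∈ Kfix)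
    (hcommHecke : ∀ g₁ g₂ : G, ∀ v ∈ Q.toSubmodule ⊓ Kfix, P (π g₁ (P (π g₂ v))) = P (π g₂ (P (π g₁ v)))) :
    ∃ v₀ ∈ Q.toSubmodule ⊓ Kfix, Q.toSubmodule ⊓ Kfix = ℂ ∙ v₀ := by
  set E : Submodule ℂ V := Q.toSubmodule ⊓ Kfix with hE
  -- `Kfix = {v | P v = v}` is closed, so `E` is a closed subspace of `V`, a Hilbert space
  have hKc : IsClosed (Kfix : Set V) := by
    have hset : (Kfix : Set V) = {v : V | P v = v} := by
      ext v
      simp only [SetLike.mem_coe, Set.mem_setOf_eq]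
      exact ⟨fun h => hPfix v h, fun h => by rw [← h]; exact hPK v⟩
    rw [hset]
    exact isClosed_eq P.continuous continuous_id
  have hEc : IsClosed (E : Set V) := by
    rw [hE, Submodule.coe_inf]
    exact Q.isClosed.inter hKc
  haveI : CompleteSpace E := hEc.completeSpace_coe
  have hPQ : ∀ v ∈ Q, P v ∈ Q := apply_mem_of_symmetric_of_fixed hu Q K Kfix hKfix P hPsymm hPfix hPK
  -- the Hecke operators `T g = (P ∘ π g)|_E`
  have hmaps : ∀ g : G, ∀ v ∈ E, (P.comp (π g)) v ∈ E := fun g v hv =>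
    ⟨hPQ _ (Q.apply_mem g hv.1), hPK _⟩
  set T : G → (E →L[ℂ] E) := fun g => (P.comp (π g)).restrict (hmaps g) with hT
  have hTapply : ∀ (g : G) (w : E), ((T g w : E) : V) = P (π g (w : V)) := fun g w => rfl
  -- (a) topologically irreducible, by ★ T8∕(A1)
  have hirr : IsIrreducibleFamily (Set.range T) := by
    intro W hWc hWinv
    by_cases hW0 : W = ⊥
    · exact Or.inl hW0
    right
    set W' : Submodule ℂ V := W.map E.subtype with hW'
    have hW'c : IsClosed (W' : Set V) := by
      rw [hW', Submodule.map_coe]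
      exact hEc.isClosedEmbedding_subtypeVal.isClosedMap _ hWc
    have hW'E : W' ≤ E := by
      rintro _ ⟨w, -, rfl⟩
      exact w.2
    have hW'0 : W' ≠ ⊥ := by
      intro h
      apply hW0
      rw [eq_bot_iff]
      intro w hw
      have h1 : (w : V) ∈ W' := ⟨w, hw, rfl⟩
      rw [h, Submodule.mem_bot] at h1
      rw [Submodule.mem_bot]
      exact Subtype.ext h1
    have hstab : ∀ g : G, ∀ v ∈ W', P (π g v) ∈ W' := by
      rintro g _ ⟨w, hw, rfl⟩
      exact ⟨T g w, hWinv _ ⟨g, rfl⟩ w hw, rfl⟩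
    have hEW' : E = W' :=
      inf_eq_of_isTopIrreducible_of_stable hQ P Kfix hPfix hW'c hW'0 (fun v hv => (hW'E hv).1) (fun v hv => (hW'E hv).2) hstab
    rw [eq_top_iff]
    rintro w -
    have hw : (w : V) ∈ W' := by rw [← hEW']; exact w.2
    obtain ⟨w₁, hw₁, hw₁w⟩ := hw
    have : w₁ = w := Subtype.ext hw₁w
    rw [← this]
    exact hw₁
  -- (b) adjoint-closed: `(T g)† = T g⁻¹`
  have hadj : ∀ g : G, ContinuousLinearMap.adjoint (T g) = T g⁻¹ := by
    intro g
    symm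
    rw [ContinuousLinearMap.eq_adjoint_iff]
    intro x y
    rw [Submodule.coe_inner, Submodule.coe_inner, hTapply, hTapply, hPsymm, hPfix _ y.2.2, ← hPsymm, hPfix _ x.2.2,
      ← hu.inner_map_map g (π g⁻¹ (x : V)) (y : V)]
    congr 1
    calc π g (π g⁻¹ (x : V)) = (π g * π g⁻¹) (x : V) := rfl
      _ = (x : V) := by rw [← map_mul, mul_inv_cancel, map_one]; rfl
  -- (c) commutative: the letter
  have hcomm : ∀ g₁ g₂ : G, Commute (T g₁) (T g₂) := by
    intro g₁ g₂
    refine ContinuousLinearMap.ext fun w => Subtype.ext ?_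
    change ((T g₁ (T g₂ w) : E) : V) = ((T g₂ (T g₁ w) : E) : V)
    rw [hTapply, hTapply, hTapply, hTapply]
    exact hcommHecke g₁ g₂ (w : V) w.2
  -- §1
  obtain ⟨v₀, hv₀⟩ := exists_forall_smul_eq_of_isIrreducibleFamily hirr
    (by rintro _ ⟨g, rfl⟩; exact ⟨g⁻¹, (hadj g).symm⟩) (by rintro _ ⟨g₁, rfl⟩ _ ⟨g₂, rfl⟩; exact hcomm g₁ g₂)
  refine ⟨(v₀ : V), v₀.2, le_antisymm (fun v hv => ?_) ((Submodule.span_singleton_le_iff_mem _ _).2 v₀.2)⟩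
  obtain ⟨c, hc⟩ := hv₀ ⟨v, hv⟩
  exact Submodule.mem_span_singleton.2 ⟨c, by rw [← Submodule.coe_smul, hc]⟩

/-- **`Π ⊓ Kfix` IS FINITE-DIMENSIONAL** on the letter `hcommHecke` (generic `P = P_K`) — T9's `hadm` for one irreducible `Π`. [cite: DeitmarEchterhoff2014, Thm. 5.1.6] [cite: Bump1997, Thm. 4.6.2] -/
theorem finiteDimensional_inf_of_commute (hu : π.IsUnitary) {Q : ClosedSubrep π} (hQ : Q.toContRep.IsTopIrreducible)
    {S : Type*} [SetLike S G] (K : S) (Kfix : Submodule ℂ V) (hKfix : ∀ v : V, v ∈ Kfix ↔ ∀ k ∈ K, π k v = v)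
    (P : V →L[ℂ] V) (hPsymm : ∀ x y : V, ⟪P x, y⟫_ℂ = ⟪x, P y⟫_ℂ) (hPfix : ∀ w ∈ Kfix, P w = w) (hPK : ∀ v : V, P v ∈ Kfix)
    (hcommHecke : ∀ g₁ g₂ : G, ∀ v ∈ Q.toSubmodule ⊓ Kfix, P (π g₁ (P (π g₂ v))) = P (π g₂ (P (π g₁ v)))) :
    FiniteDimensional ℂ ↥(Q.toSubmodule ⊓ Kfix) := by
  obtain ⟨v₀, -, h⟩ := inf_eq_span_singleton_of_commute hu hQ K Kfix hKfix P hPsymm hPfix hPK hcommHecke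
  rw [h]
  infer_instance

/-- **`finrank (Π ⊓ Kfix) ≤ 1`** on the letter `hcommHecke` (generic `P = P_K`): multiplicity one of the trivial `K`-type. [cite: DeitmarEchterhoff2014, Thm. 5.1.6] [cite: Bump1997, Thm. 4.6.2] -/
theorem finrank_inf_le_one_of_commute (hu : π.IsUnitary) {Q : ClosedSubrep π} (hQ : Q.toContRep.IsTopIrreducible)
    {S : Type*} [SetLike S G] (K : S) (Kfix : Submodule ℂ V) (hKfix : ∀ v : V, v ∈ Kfix ↔ ∀ k ∈ K, π k v = v)
    (P : V →L[ℂ] V) (hPsymm : ∀ x y : V, ⟪P x, y⟫_ℂ = ⟪x, P y⟫_ℂ) (hPfix : ∀ w ∈ Kfix, P w = w) (hPK : ∀ v : V, P v ∈ Kfix)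
    (hcommHecke : ∀ g₁ g₂ : G, ∀ v ∈ Q.toSubmodule ⊓ Kfix, P (π g₁ (P (π g₂ v))) = P (π g₂ (P (π g₁ v)))) :
    Module.finrank ℂ ↥(Q.toSubmodule ⊓ Kfix) ≤ 1 := by
  obtain ⟨v₀, -, h⟩ := inf_eq_span_singleton_of_commute hu hQ K Kfix hKfix P hPsymm hPfix hPK hcommHecke
  rw [h]
  exact (finrank_span_le_card ({v₀} : Set V)).trans (by simp)

end Head

/-! ## §4 The same with Mathlib's orthogonal projection `P := Kfix.starProjection` (the dealer's bytes), and T9's letter shape `hadm` -/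

section StarProjection

variable {G V : Type*} [Group G] [NormedAddCommGroup V] [InnerProductSpace ℂ V] [CompleteSpace V] {π : ContRepresentation ℂ G V}

omit [CompleteSpace V] in
/-- The fixed vectors of any family of group elements form a CLOSED subspace (an intersection of kernels of the continuous `π k - 1`). [cite: DeitmarEchterhoff2014, Lemma 7.3.1] -/
theorem isClosed_of_fixed {S : Type*} [SetLike S G] (K : S) (Kfix : Submodule ℂ V) (hKfix : ∀ v : V, v ∈ Kfix ↔ ∀ k ∈ K, π k v = v) :
    IsClosed (Kfix : Set V) := by
  have hset : (Kfix : Set V) = ⋂ k ∈ (K : Set G), {v : V | π k v = v} := by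
    ext v
    simp only [SetLike.mem_coe, Set.mem_iInter, Set.mem_setOf_eq]
    exact hKfix v
  rw [hset]
  exact isClosed_biInter fun k _ => isClosed_eq (π k).continuous continuous_id

/-- The closed subspace `Kfix` of the Hilbert space `V` HAS an orthogonal projection (Mathlib `HasOrthogonalProjection.ofCompleteSpace`); a `Prop`-valued class, recorded as a theorem so
that consumers can `haveI` it before writing `Kfix.starProjection`. [cite: DeitmarEchterhoff2014, Lemma 7.3.1] -/
theorem hasOrthogonalProjection_of_fixed {S : Type*} [SetLike S G] (K : S) (Kfix : Submodule ℂ V) (hKfix : ∀ v : V, v ∈ Kfix ↔ ∀ k ∈ K, π k v = v) :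
    Kfix.HasOrthogonalProjection := by
  haveI : CompleteSpace Kfix := (isClosed_of_fixed K Kfix hKfix).completeSpace_coe
  exact Submodule.HasOrthogonalProjection.ofCompleteSpace Kfix

/-- **(A3) IN THE DEALER'S BYTES** (`P = Kfix.starProjection`): for `π` unitary, `Π` topologically irreducible, `K ⊆ G` with fixed vectors `Kfix`, and the LETTER
`hcommHecke : ∀ g₁ g₂, ∀ v ∈ Π.toSubmodule ⊓ Kfix, P (π g₁ (P (π g₂ v))) = P (π g₂ (P (π g₁ v)))`: **`∃ v₀ ∈ Π ⊓ Kfix, Π.toSubmodule ⊓ Kfix = ℂ ∙ v₀`**.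
[cite: DeitmarEchterhoff2014, Thm. 5.1.6 and Lemma 6.1.7] [cite: Bump1997, Thm. 2.4.2 and Thm. 4.6.2] [cite: Garrett2018, p. 331] -/
theorem inf_eq_span_singleton_of_hcommHecke (hu : π.IsUnitary) {Q : ClosedSubrep π} (hQ : Q.toContRep.IsTopIrreducible)
    {S : Type*} [SetLike S G] (K : S) (Kfix : Submodule ℂ V) (hKfix : ∀ v : V, v ∈ Kfix ↔ ∀ k ∈ K, π k v = v) [Kfix.HasOrthogonalProjection]
    (hcommHecke : ∀ g₁ g₂ : G, ∀ v ∈ Q.toSubmodule ⊓ Kfix,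
      Kfix.starProjection (π g₁ (Kfix.starProjection (π g₂ v))) = Kfix.starProjection (π g₂ (Kfix.starProjection (π g₁ v)))) :
    ∃ v₀ ∈ Q.toSubmodule ⊓ Kfix, Q.toSubmodule ⊓ Kfix = ℂ ∙ v₀ :=
  inf_eq_span_singleton_of_commute hu hQ K Kfix hKfix Kfix.starProjection (Submodule.inner_starProjection_left_eq_right Kfix)
    (fun _ hw => Submodule.starProjection_eq_self_iff.2 hw) (Submodule.starProjection_apply_mem Kfix) hcommHecke

/-- **`Π ⊓ Kfix` IS FINITE-DIMENSIONAL** on the letter `hcommHecke` (`P = Kfix.starProjection`). [cite: DeitmarEchterhoff2014, Thm. 5.1.6] [cite: Bump1997, Thm. 4.6.2] -/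
theorem finiteDimensional_inf_of_hcommHecke (hu : π.IsUnitary) {Q : ClosedSubrep π} (hQ : Q.toContRep.IsTopIrreducible)
    {S : Type*} [SetLike S G] (K : S) (Kfix : Submodule ℂ V) (hKfix : ∀ v : V, v ∈ Kfix ↔ ∀ k ∈ K, π k v = v) [Kfix.HasOrthogonalProjection]
    (hcommHecke : ∀ g₁ g₂ : G, ∀ v ∈ Q.toSubmodule ⊓ Kfix,
      Kfix.starProjection (π g₁ (Kfix.starProjection (π g₂ v))) = Kfix.starProjection (π g₂ (Kfix.starProjection (π g₁ v)))) :
    FiniteDimensional ℂ ↥(Q.toSubmodule ⊓ Kfix) := by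
  obtain ⟨v₀, -, h⟩ := inf_eq_span_singleton_of_hcommHecke hu hQ K Kfix hKfix hcommHecke
  rw [h]
  infer_instance

/-- **`finrank (Π ⊓ Kfix) ≤ 1`** on the letter `hcommHecke` (`P = Kfix.starProjection`): multiplicity one of the trivial `K`-type, the shortcut for §2 of ★ T9 p859502.
[cite: DeitmarEchterhoff2014, Thm. 5.1.6] [cite: Bump1997, Thm. 4.6.2] -/
theorem finrank_inf_le_one_of_hcommHecke (hu : π.IsUnitary) {Q : ClosedSubrep π} (hQ : Q.toContRep.IsTopIrreducible)
    {S : Type*} [SetLike S G] (K : S) (Kfix : Submodule ℂ V) (hKfix : ∀ v : V, v ∈ Kfix ↔ ∀ k ∈ K, π k v = v) [Kfix.HasOrthogonalProjection]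
    (hcommHecke : ∀ g₁ g₂ : G, ∀ v ∈ Q.toSubmodule ⊓ Kfix,
      Kfix.starProjection (π g₁ (Kfix.starProjection (π g₂ v))) = Kfix.starProjection (π g₂ (Kfix.starProjection (π g₁ v)))) :
    Module.finrank ℂ ↥(Q.toSubmodule ⊓ Kfix) ≤ 1 := by
  obtain ⟨v₀, -, h⟩ := inf_eq_span_singleton_of_hcommHecke hu hQ K Kfix hKfix hcommHecke
  rw [h]
  exact (finrank_span_le_card ({v₀} : Set V)).trans (by simp)

/-- **T9's LETTER `hadm` ON THE LETTER `hcommHecke`** (★ p859502 `fixed_residual_mem_span_of_letters`, binder bytes): for a closed invariant `Res` (think `L²_res`) on whose `K`-fixed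
vectors the Hecke operators `P π(g) P` (`P = Kfix.starProjection`) commute, **every irreducible closed `W ≤ Res` has `W.toSubmodule ⊓ Kfix` finite-dimensional** (indeed a line or zero).
[cite: DeitmarEchterhoff2014, Thm. 5.1.6 and Lemma 6.1.7] [cite: Bump1997, Thm. 4.6.2] [cite: MoeglinWaldspurger1995, V.3.13] -/
theorem hadm_of_hcommHecke (hu : π.IsUnitary) (Res : ClosedSubrep π)
    {S : Type*} [SetLike S G] (K : S) (Kfix : Submodule ℂ V) (hKfix : ∀ v : V, v ∈ Kfix ↔ ∀ k ∈ K, π k v = v) [Kfix.HasOrthogonalProjection]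
    (hcommHecke : ∀ g₁ g₂ : G, ∀ v ∈ Res.toSubmodule ⊓ Kfix,
      Kfix.starProjection (π g₁ (Kfix.starProjection (π g₂ v))) = Kfix.starProjection (π g₂ (Kfix.starProjection (π g₁ v)))) :
    ∀ W : ClosedSubrep π, W ≤ Res → W.toContRep.IsTopIrreducible → FiniteDimensional ℂ ↥(W.toSubmodule ⊓ Kfix) :=
  fun _ hWres hWirr => finiteDimensional_inf_of_hcommHecke hu hWirr K Kfix hKfix
    fun g₁ g₂ v hv => hcommHecke g₁ g₂ v ⟨hWres hv.1, hv.2⟩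

/-- T9's letter `hadm` on the letter `hcommHecke`, GENERIC `P = P_K` edition (symmetric, `P|_{Kfix} = id`, `P(V) ⊆ Kfix` — e.g. the `K`-average `∫_K π(k) dk`).
[cite: DeitmarEchterhoff2014, Thm. 5.1.6 and Lemma 6.1.7] [cite: Bump1997, Thm. 4.6.2] -/
theorem hadm_of_commute (hu : π.IsUnitary) (Res : ClosedSubrep π)
    {S : Type*} [SetLike S G] (K : S) (Kfix : Submodule ℂ V) (hKfix : ∀ v : V, v ∈ Kfix ↔ ∀ k ∈ K, π k v = v)
    (P : V →L[ℂ] V) (hPsymm : ∀ x y : V, ⟪P x, y⟫_ℂ = ⟪x, P y⟫_ℂ) (hPfix : ∀ w ∈ Kfix, P w = w) (hPK : ∀ v : V, P v ∈ Kfix)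
    (hcommHecke : ∀ g₁ g₂ : G, ∀ v ∈ Res.toSubmodule ⊓ Kfix, P (π g₁ (P (π g₂ v))) = P (π g₂ (P (π g₁ v)))) :
    ∀ W : ClosedSubrep π, W ≤ Res → W.toContRep.IsTopIrreducible → FiniteDimensional ℂ ↥(W.toSubmodule ⊓ Kfix) :=
  fun _ hWres hWirr => finiteDimensional_inf_of_commute hu hWirr K Kfix hKfix P hPsymm hPfix hPK
    fun g₁ g₂ v hv => hcommHecke g₁ g₂ v ⟨hWres hv.1, hv.2⟩

end StarProjection

/-! ## §5 CM prints: `L²_res(U(Φ_N)(L⁺)∖U(Φ_N)(𝔸_{L⁺}))` = ★ `cmResidualSubspaceR L N μ` (every `N`; ★ p859502 reads `N = 2`) -/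

section CM

variable (L : Type) [Field L] [NumberField L] [IsCMField L] (N : ℕ)
  (μ : Measure (UnitaryGroup.cmDatum L N (Matrix.of fun i j : Fin N => if i.val + j.val + 1 = N then (1 : L) else 0)).automorphicQuotient)
  [(UnitaryGroup.cmDatum L N (Matrix.of fun i j : Fin N => if i.val + j.val + 1 = N then (1 : L) else 0)).IsAutomorphicMeasure μ]

/-- **T9's `hadm` AT `L²_res(U(Φ_N))` ON THE LETTER `hcommHecke`** (`P = Kfix.starProjection`, the dealer's bytes): for every `K_U ≤ U(Φ_N)(𝔸_{L⁺})` with fixed vectors `Kfix` on which the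
Hecke operators of `L²_res ⊓ Kfix` commute, **`∀ W ≤ cmResidualSubspaceR L N μ` irreducible, `FiniteDimensional ℂ ↥(W.toSubmodule ⊓ Kfix)`** — ★ p859502's binder `hadm` (N = 2).
[cite: DeitmarEchterhoff2014, Thm. 5.1.6 and Lemma 6.1.7] [cite: Bump1997, Thm. 4.6.2] [cite: MoeglinWaldspurger1995, V.3.13] [cite: Rogawski1990, §13.5] -/
theorem cmResidualSubspaceR_hadm_of_hcommHecke
    (K_U : Subgroup (UnitaryGroup.cmDatum L N (Matrix.of fun i j : Fin N => if i.val + j.val + 1 = N then (1 : L) else 0)).Adelic)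
    (Kfix : Submodule ℂ ((UnitaryGroup.cmDatum L N (Matrix.of fun i j : Fin N => if i.val + j.val + 1 = N then (1 : L) else 0)).L2 μ))
    (hKfix : ∀ v, v ∈ Kfix ↔ ∀ k ∈ K_U, (UnitaryGroup.cmDatum L N (Matrix.of fun i j : Fin N => if i.val + j.val + 1 = N then (1 : L) else 0)).rightRegular μ k v = v)
    [Kfix.HasOrthogonalProjection]
    (hcommHecke : ∀ g₁ g₂ : (UnitaryGroup.cmDatum L N (Matrix.of fun i j : Fin N => if i.val + j.val + 1 = N then (1 : L) else 0)).Adelic,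
      ∀ v ∈ (cmResidualSubspaceR L N μ).toSubmodule ⊓ Kfix,
        Kfix.starProjection ((UnitaryGroup.cmDatum L N (Matrix.of fun i j : Fin N => if i.val + j.val + 1 = N then (1 : L) else 0)).rightRegular μ g₁
          (Kfix.starProjection ((UnitaryGroup.cmDatum L N (Matrix.of fun i j : Fin N => if i.val + j.val + 1 = N then (1 : L) else 0)).rightRegular μ g₂ v))) =
        Kfix.starProjection ((UnitaryGroup.cmDatum L N (Matrix.of fun i j : Fin N => if i.val + j.val + 1 = N then (1 : L) else 0)).rightRegular μ g₂
          (Kfix.starProjection ((UnitaryGroup.cmDatum L N (Matrix.of fun i j : Fin N => if i.val + j.val + 1 = N then (1 : L) else 0)).rightRegular μ g₁ v)))) :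
    ∀ W : ClosedSubrep ((UnitaryGroup.cmDatum L N (Matrix.of fun i j : Fin N => if i.val + j.val + 1 = N then (1 : L) else 0)).rightRegular μ),
      W ≤ cmResidualSubspaceR L N μ → W.toContRep.IsTopIrreducible → FiniteDimensional ℂ ↥(W.toSubmodule ⊓ Kfix) :=
  hadm_of_hcommHecke ((UnitaryGroup.cmDatum L N _).isUnitary_rightRegular μ) (cmResidualSubspaceR L N μ) K_U Kfix hKfix hcommHecke

/-- **`finrank (Π ⊓ Kfix) ≤ 1` FOR EVERY IRREDUCIBLE `Π ≤ L²_res(U(Φ_N))` ON THE LETTER `hcommHecke`** — multiplicity one of the trivial `K_U`-type in the residual spectrum (the shortcut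
for §2 of ★ p859502). [cite: DeitmarEchterhoff2014, Thm. 5.1.6] [cite: Bump1997, Thm. 4.6.2] [cite: MoeglinWaldspurger1995, V.3.13] -/
theorem cmResidualSubspaceR_finrank_inf_le_one_of_hcommHecke
    (K_U : Subgroup (UnitaryGroup.cmDatum L N (Matrix.of fun i j : Fin N => if i.val + j.val + 1 = N then (1 : L) else 0)).Adelic)
    (Kfix : Submodule ℂ ((UnitaryGroup.cmDatum L N (Matrix.of fun i j : Fin N => if i.val + j.val + 1 = N then (1 : L) else 0)).L2 μ))
    (hKfix : ∀ v, v ∈ Kfix ↔ ∀ k ∈ K_U, (UnitaryGroup.cmDatum L N (Matrix.of fun i j : Fin N => if i.val + j.val + 1 = N then (1 : L) else 0)).rightRegular μ k v = v)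
    [Kfix.HasOrthogonalProjection]
    (hcommHecke : ∀ g₁ g₂ : (UnitaryGroup.cmDatum L N (Matrix.of fun i j : Fin N => if i.val + j.val + 1 = N then (1 : L) else 0)).Adelic,
      ∀ v ∈ (cmResidualSubspaceR L N μ).toSubmodule ⊓ Kfix,
        Kfix.starProjection ((UnitaryGroup.cmDatum L N (Matrix.of fun i j : Fin N => if i.val + j.val + 1 = N then (1 : L) else 0)).rightRegular μ g₁
          (Kfix.starProjection ((UnitaryGroup.cmDatum L N (Matrix.of fun i j : Fin N => if i.val + j.val + 1 = N then (1 : L) else 0)).rightRegular μ g₂ v))) =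
        Kfix.starProjection ((UnitaryGroup.cmDatum L N (Matrix.of fun i j : Fin N => if i.val + j.val + 1 = N then (1 : L) else 0)).rightRegular μ g₂
          (Kfix.starProjection ((UnitaryGroup.cmDatum L N (Matrix.of fun i j : Fin N => if i.val + j.val + 1 = N then (1 : L) else 0)).rightRegular μ g₁ v)))) :
    ∀ W : ClosedSubrep ((UnitaryGroup.cmDatum L N (Matrix.of fun i j : Fin N => if i.val + j.val + 1 = N then (1 : L) else 0)).rightRegular μ),
      W ≤ cmResidualSubspaceR L N μ → W.toContRep.IsTopIrreducible → Module.finrank ℂ ↥(W.toSubmodule ⊓ Kfix) ≤ 1 :=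
  fun _ hWres hWirr => finrank_inf_le_one_of_hcommHecke ((UnitaryGroup.cmDatum L N _).isUnitary_rightRegular μ) hWirr K_U Kfix hKfix
    fun g₁ g₂ v hv => hcommHecke g₁ g₂ v ⟨hWres hv.1, hv.2⟩

end CM

end Summit.HodgeConjecture.HodgeConjecture.Cruxes.H413.K2E1ResidualSphericalMultiplicityOneOfLetters

end
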